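import Summits.CriticalPhenomena.SAWScalingLimit.Theorems.SAWDevelopingMapObservableToSLETypeLadderCarvedReductionSqueezeCells
import HarnessLib

/-!
# The realised cells of the moving-carving squeeze, fixed-radius form (piece (STAGE 2′ cells) of
# stub STAGE 2′ `stub_carvedReduction_squeezeGeometry_lattice2`)

Crux `SAWDevelopingMap.ObservableToSLE` (stmt-CriticalPhenomena-10472), line `six-class-type-ladder`,
stub STAGE 2′ `stub_carvedReduction_squeezeGeometry_lattice2`.  Landing target:
`Summits/CriticalPhenomena/SAWScalingLimit/Theorems/SAWDevelopingMapObservableToSLETypeLadderCarvedReductionSqueezeCells2.lean`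
(`--supports stmt-CriticalPhenomena-10472`).  Sequel of `…SqueezeCells` (p136631).

THE PER-INDEX LATTICE CLAUSES of the squeeze, exactly as in `…SqueezeCells` (`squeeze_cells`), but
with the geometric fact (MU) of the pinned frame in its FIXED-RADIUS form: the old form of (MU)
("for every `r > 0`, eventually every vertex of `M` at distance `≥ r` from both gates is not
removed") is unsatisfiable for admissible data — at one gate a band of removed rows of height
`o(1) ≫ δ` may sit ABOVE the limit line inside the flat half-disc of `M`; only the vertices `ρX`-far
from both gates are controlled.  Accordingly `squeeze_cells'` takes ONE exemption radius `ρX` with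
`ρX ≤ ρc`, `ρX ≤ ρc'`, the exactness (U) of the removed set in the `ρX`-balls about the gates, (MU) off
these balls, and the depth clause of the inner family `Λ'` INCLUDING its row clause (verbatim as
output by `twoPiece_nested_families`, `…SqueezeNested` p136621).  The only new step is "(3) the cell
misses `U_j`": a member of `Λ''_j` whose pinned centre is within `ρX` of a gate `E.pt i` has
`|re - re (E.pt i)| < ρX ≤ ρc < ρc + 10 s_j` and `|im - im (E.pt i)| < ρX ≤ ρc'`, so the row clause
puts it at or above the gate row while (U) puts a removed vertex strictly below it; a member
`ρX`-far from both gates is not removed by (MU).  Everything else is copied from `squeeze_cells`.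
Registered carrier: `stub_carvedReduction_cells2`.
-/

noncomputable section

open scoped Topology
open Filter Set Metric
open Literature.Probability.LatticeModels (HexVertex hexGraph hexCenter triEmbed Site)
open Literature.Probability.RandomPlanarGeometry
open Literature.Probability.RandomPlanarGeometry.SAW
open Literature.Probability.Percolation (PathIn)

namespace Summit.CriticalPhenomena.SAWScalingLimit.Theorems.ObservableToSLE.TypeLadder

open Summit.CriticalPhenomena.SAWScalingLimit.Theorems.ObservableToSLE.FloorRatio (hexGraph_adj_below)
open Summit.CriticalPhenomena.SAWScalingLimit.Theorems.ObservableToSLER.TwoPiece (dist_smul_hexCenter_le_of_adj)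

/-! ### A box test from a ball -/

/-- A point of the open `ρX`-ball about `p`, `ρX ≤ ρc`, `ρX ≤ ρc'`, lies in the open box
`|re - re p| < ρc + t`, `|im - im p| < ρc'` for every `t > 0`. -/
theorem abs_re_im_lt_of_mem_ball {z p : ℂ} {ρX ρc ρc' t : ℝ} (hz : z ∈ ball p ρX) (hXc : ρX ≤ ρc)
    (hXc' : ρX ≤ ρc') (ht : 0 < t) : |z.re - p.re| < ρc + t ∧ |z.im - p.im| < ρc' := by
  have hd : ‖z - p‖ < ρX := by rw [← dist_eq_norm]; exact mem_ball.1 hz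
  refine ⟨?_, ?_⟩
  · rw [← Complex.sub_re]
    exact (Complex.abs_re_le_norm _).trans_lt (by linarith)
  · rw [← Complex.sub_im]
    exact (Complex.abs_im_le_norm _).trans_lt (by linarith)

/-- **Registered sub-goal `stub_carvedReduction_cells2`** (crux item stmt-CriticalPhenomena-10472,
stub STAGE 2′ `stub_carvedReduction_squeezeGeometry_lattice2`, piece (STAGE 2′ cells)): registry
form of `abs_re_im_lt_of_mem_ball` — the open `ρX`-ball about a gate lies in the open gate box. -/
theorem stub_carvedReduction_cells2 :
    ∀ (z p : ℂ) (ρX ρc ρc' t : ℝ), z ∈ ball p ρX → ρX ≤ ρc → ρX ≤ ρc' → 0 < t →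
      |z.re - p.re| < ρc + t ∧ |z.im - p.im| < ρc' :=
  fun _ _ _ _ _ _ hz hXc hXc' ht => abs_re_im_lt_of_mem_ball hz hXc hXc' ht

/-! ### The cells -/

/-- **THE REALISED CELLS, fixed-radius form**; see the module docstring.  Notation:
`τ_j = s_j · triEmbed x_j`; the exempt slabs and the clearly-deep set are those of `…SqueezeFamily`
for the gate points `E.pt i`, box half-width `ρc`, depth `ρc'`, thresholds `g i δ 1`; `ρX` is the
exemption radius of (U)/(MU). -/
theorem squeeze_cells' {Ω : Set ℂ} (E M : DobrushinDomain) {s : ℕ → ℝ} {U : ℕ → Set HexVertex}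
    {q q' p p' : ℕ → HexVertex} {x : ℕ → Site 2} {N Λ' : ℝ → Finset HexVertex}
    {a b : ℝ → Sym2 HexVertex} {g : Fin 2 → ℝ → Site 2} {ρX ρc ρc' : ℝ}
    (hs0 : Tendsto s atTop (𝓝[>] 0)) (hρX : 0 < ρX) (hρc : 0 < ρc) (hXc : ρX ≤ ρc) (hXc' : ρX ≤ ρc')
    -- the pinned gates
    (hq : ∀ j, q j = ((x j + g 0 (s j), 0) : HexVertex))
    (hp : ∀ j, p j = ((x j + (g 0 (s j) - Pi.single 1 1), 1) : HexVertex))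
    (hq' : ∀ j, q' j = ((x j + g 1 (s j), 0) : HexVertex))
    (hp' : ∀ j, p' j = ((x j + (g 1 (s j) - Pi.single 1 1), 1) : HexVertex))
    (hglim : ∀ i, Tendsto (fun j => (s j : ℂ) * hexCenter ((g i (s j), 0) : HexVertex)) atTop (𝓝 (E.pt i)))
    -- the families (from `…SqueezeNested`)
    (ha : ∀ δ, a δ = s(((g 0 δ, 0) : HexVertex), (g 0 δ - Pi.single 1 1, 1)))
    (hb : ∀ δ, b δ = s(((g 1 δ, 0) : HexVertex), (g 1 δ - Pi.single 1 1, 1)))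
    (hinM : ∀ᶠ δ : ℝ in 𝓝[>] 0, (hexGraph.induce (↑(Λ' δ) : Set HexVertex)).Preconnected ∧
      ∀ v ∈ Λ' δ, (δ : ℂ) * hexCenter v ∈ M.carrier)
    (hdepth : ∀ᶠ δ : ℝ in 𝓝[>] 0, ∀ v ∈ Λ' δ,
      closedBall ((δ : ℂ) * hexCenter v) (25 * δ) ⊆ M.carrier ∪
          ⋃ i, {x : ℂ | |x.re - (E.pt i).re| ≤ ρc ∧ (E.pt i).im - 30 * δ ≤ x.im ∧ x.im ≤ (E.pt i).im} ∧
        ∀ i, |((δ : ℂ) * hexCenter v).re - (E.pt i).re| < ρc + 10 * δ →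
          |((δ : ℂ) * hexCenter v).im - (E.pt i).im| < ρc' → g i δ 1 ≤ v.1 1)
    (hclosed : ∀ᶠ δ : ℝ in 𝓝[>] 0, ∀ z w : HexVertex, z ∈ N δ →
      PathIn hexGraph {u : HexVertex | (δ : ℂ) * hexCenter u ∈ E.carrier ∧
        closedBall ((δ : ℂ) * hexCenter u) (25 * δ) ⊆ E.carrier ∪
          ⋃ i, {x : ℂ | |x.re - (E.pt i).re| ≤ ρc ∧ (E.pt i).im - 30 * δ ≤ x.im ∧ x.im ≤ (E.pt i).im} ∧
        ∀ i, |((δ : ℂ) * hexCenter u).re - (E.pt i).re| < ρc + 10 * δ →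
          |((δ : ℂ) * hexCenter u).im - (E.pt i).im| < ρc' → g i δ 1 ≤ u.1 1} z w → w ∈ N δ)
    (hfaces : ∀ᶠ δ : ℝ in 𝓝[>] 0, ((g 0 δ, 0) : HexVertex) ∈ N δ ∧ ((g 0 δ, 0) : HexVertex) ∈ Λ' δ ∧
      ((g 1 δ, 0) : HexVertex) ∈ N δ ∧ ((g 1 δ, 0) : HexVertex) ∈ Λ' δ ∧
      ((g 0 δ - Pi.single 1 1, 1) : HexVertex) ∉ N δ ∧ ((g 1 δ - Pi.single 1 1, 1) : HexVertex) ∉ N δ ∧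
      a δ ≠ b δ)
    -- the geometric facts of the pinned frame
    (hU : ∀ᶠ j in atTop, ∀ (i : Fin 2) (v : HexVertex),
      (s j : ℂ) * hexCenter v - (s j : ℂ) * triEmbed (x j) ∈ ball (E.pt i) ρX →
        (v ∈ U j ↔ v.1 1 < x j 1 + g i (s j) 1))
    (hMD : ∀ᶠ j in atTop, ∀ z : ℂ, (z ∈ M.carrier ∨ ∃ i, dist z (E.pt i) ≤ 2 * ρc) →
      z + (s j : ℂ) * triEmbed (x j) ∈ Ω)
    (hMU : ∀ᶠ j in atTop, ∀ v : HexVertex,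
      (s j : ℂ) * hexCenter v - (s j : ℂ) * triEmbed (x j) ∈ M.carrier →
        (∀ i, ρX ≤ dist ((s j : ℂ) * hexCenter v - (s j : ℂ) * triEmbed (x j)) (E.pt i)) → v ∉ U j)
    (hreach : ∀ᶠ j in atTop, ∀ (w : HexVertex) (π : (hexDomainGraph Ω (s j)).Walk (q j) w),
      (∀ y ∈ π.support, y ∉ U j) → ∀ y ∈ π.support,
        ((-(x j) + y.1, y.2) : HexVertex) ∈ {u : HexVertex | ((s j : ℝ) : ℂ) * hexCenter u ∈ E.carrier ∧
          closedBall (((s j : ℝ) : ℂ) * hexCenter u) (25 * s j) ⊆ E.carrier ∪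
            ⋃ i, {x : ℂ | |x.re - (E.pt i).re| ≤ ρc ∧ (E.pt i).im - 30 * s j ≤ x.im ∧ x.im ≤ (E.pt i).im} ∧
          ∀ i, |(((s j : ℝ) : ℂ) * hexCenter u).re - (E.pt i).re| < ρc + 10 * s j →
            |(((s j : ℝ) : ℂ) * hexCenter u).im - (E.pt i).im| < ρc' → g i (s j) 1 ≤ u.1 1})
    (hqdom : ∀ j, q j ∈ embMeshDomain hexGraph hexCenter Ω (s j)) :
    ∃ Λ'' : ℕ → Finset HexVertex,
      (∀ j (w : HexVertex), w ∈ Λ'' j ↔ ((-(x j) + w.1, w.2) : HexVertex) ∈ Λ' (s j)) ∧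
      ∀ᶠ j in atTop,
        (∀ w ∈ Λ'' j, w ∉ U j) ∧
        (∀ w ∈ Λ'' j, ∀ y ∈ Λ'' j, hexGraph.Adj w y → (hexDomainGraph Ω (s j)).Adj w y) ∧
        q j ∈ Λ'' j ∧ p j ∈ U j ∧ p' j ∈ U j ∧ hexGraph.Adj (q j) (p j) ∧
        s(q j, p j) ≠ s(q' j, p' j) ∧
        (a (s j)).map (fun w : HexVertex => ((x j + w.1, w.2) : HexVertex)) = s(q j, p j) ∧
        (b (s j)).map (fun w : HexVertex => ((x j + w.1, w.2) : HexVertex)) = s(q' j, p' j) ∧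
        (∀ (w : HexVertex) (π : (hexDomainGraph Ω (s j)).Walk (q j) w),
          (∀ y ∈ π.support, y ∉ U j) → ∀ y ∈ π.support, ((-(x j) + y.1, y.2) : HexVertex) ∈ N (s j)) ∧
        ((-(x j) + (p j).1, (p j).2) : HexVertex) ∉ N (s j) ∧
        ((-(x j) + (p' j).1, (p' j).2) : HexVertex) ∉ N (s j) := by
  classical
  -- the cells and their description
  set Λ'' : ℕ → Finset HexVertex := fun j =>
    (Λ' (s j)).image fun w : HexVertex => ((x j + w.1, w.2) : HexVertex) with hΛ''
  have hmem : ∀ j (w : HexVertex), w ∈ Λ'' j ↔ ((-(x j) + w.1, w.2) : HexVertex) ∈ Λ' (s j) := by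
    intro j w
    simp only [hΛ'', Finset.mem_image]
    constructor
    · rintro ⟨u, hu, rfl⟩
      obtain ⟨c, k⟩ := u
      simpa using hu
    · intro h
      refine ⟨_, h, ?_⟩
      obtain ⟨c, k⟩ := w; simp
  refine ⟨Λ'', hmem, ?_⟩
  -- meshes are eventually positive and small
  have hspos : ∀ᶠ j in atTop, 0 < s j := hs0.eventually self_mem_nhdsWithin
  have hsmall : ∀ᶠ j in atTop, s j < ρc / 30 :=
    hs0.eventually (mem_nhdsWithin_of_mem_nhds (Iio_mem_nhds (by positivity)))
  -- the down-faces approach the gates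
  have hpnear : ∀ i, ∀ᶠ j in atTop,
      (s j : ℂ) * hexCenter ((g i (s j) - Pi.single 1 1, 1) : HexVertex) ∈ ball (E.pt i) ρX := by
    intro i
    have h1 : ∀ᶠ j in atTop, dist ((s j : ℂ) * hexCenter ((g i (s j), 0) : HexVertex)) (E.pt i) < ρX / 2 :=
      hglim i (ball_mem_nhds _ (by positivity))
    have h2 : ∀ᶠ j in atTop, s j < ρX / 2 :=
      hs0.eventually (mem_nhdsWithin_of_mem_nhds (Iio_mem_nhds (by positivity)))
    filter_upwards [h1, h2, hspos] with j hj hsj hs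
    rw [mem_ball]
    calc dist ((s j : ℂ) * hexCenter ((g i (s j) - Pi.single 1 1, 1) : HexVertex)) (E.pt i)
        ≤ dist ((s j : ℂ) * hexCenter ((g i (s j) - Pi.single 1 1, 1) : HexVertex))
            ((s j : ℂ) * hexCenter ((g i (s j), 0) : HexVertex)) +
          dist ((s j : ℂ) * hexCenter ((g i (s j), 0) : HexVertex)) (E.pt i) := dist_triangle _ _ _
      _ < s j + ρX / 2 := by
          refine add_lt_add_of_le_of_lt ?_ hj
          rw [dist_comm]
          exact dist_smul_hexCenter_le_of_adj hs.le (hexGraph_adj_below _)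
      _ < ρX := by linarith
  filter_upwards [hspos, hsmall, hpnear 0, hpnear 1, hs0.eventually hinM,
    hs0.eventually hdepth, hs0.eventually hclosed, hs0.eventually hfaces, hU, hMD, hMU, hreach]
    with j hsj hsmallj hp0 hp1 hinMj hdepthj hclosedj hfacesj hUj hMDj hMUj hreachj
  obtain ⟨hconnL, hinML⟩ := hinMj
  obtain ⟨hg0N, hg0L, hg1N, hg1L, hd0N, hd1N, hab⟩ := hfacesj
  set τj : ℂ := (s j : ℂ) * triEmbed (x j) with hτj
  -- translated members: in `Λ'`, centre `= pinned centre + τ_j`, pinned centre in `M`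
  have hback : ∀ w ∈ Λ'' j, ((-(x j) + w.1, w.2) : HexVertex) ∈ Λ' (s j) ∧
      (s j : ℂ) * hexCenter w = (s j : ℂ) * hexCenter ((-(x j) + w.1, w.2) : HexVertex) + τj ∧
      (s j : ℂ) * hexCenter ((-(x j) + w.1, w.2) : HexVertex) ∈ M.carrier := by
    intro w hw
    have h1 := (hmem j w).1 hw
    refine ⟨h1, ?_, hinML _ h1⟩
    rw [smul_hexCenter_neg_translate]; ring
  -- (3) the cell misses `U_j`: near a gate by the row clause of the depth of `Λ'` against (U),
  -- off the gates by (MU)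
  have hmiss : ∀ w ∈ Λ'' j, w ∉ U j := by
    intro w hw hwU
    obtain ⟨hwL, hctr, hwM⟩ := hback w hw
    have hpin : (s j : ℂ) * hexCenter w - τj = (s j : ℂ) * hexCenter ((-(x j) + w.1, w.2) : HexVertex) := by
      rw [hctr]; ring
    by_cases hnear : ∃ i, (s j : ℂ) * hexCenter ((-(x j) + w.1, w.2) : HexVertex) ∈ ball (E.pt i) ρX
    · obtain ⟨i, hi⟩ := hnear
      obtain ⟨hre, him⟩ := abs_re_im_lt_of_mem_ball hi hXc hXc' (show (0 : ℝ) < 10 * s j by positivity)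
      have hrow := (hdepthj _ hwL).2 i hre him
      have hUi := (hUj i w (by rw [hpin]; exact hi)).1 hwU
      have : ((-(x j) + w.1, w.2) : HexVertex).1 1 = -(x j 1) + w.1 1 := by simp
      rw [this] at hrow
      linarith [(show ((((-(x j) + w.1, w.2) : HexVertex).1 1 : ℤ) : ℤ) = -(x j 1) + w.1 1 from this)]
    · push Not at hnear
      refine hMUj w (by rw [hpin]; exact hwM) (fun i => ?_) hwU
      rw [hpin]
      exact not_lt.1 fun h => hnear i (mem_ball.2 h)
  -- (5) the gate vertex, (6) the down-faces, (11) translated down-faces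
  have hqmem : q j ∈ Λ'' j := by
    rw [hmem, hq j]; simpa using hg0L
  have hpctr : ∀ (i : Fin 2) (y : Site 2), (s j : ℂ) * hexCenter ((x j + y, 1) : HexVertex) - τj =
      (s j : ℂ) * hexCenter ((y, 1) : HexVertex) := by
    intro i y
    have := smul_hexCenter_translate (s j) (x j) ((y, 1) : HexVertex)
    simp only at this
    rw [this]; ring
  have hpU : p j ∈ U j := by
    refine (hUj 0 (p j) ?_).2 ?_
    · rw [hp j, hpctr 0]; exact hp0
    · rw [hp j]; simp
  have hp'U : p' j ∈ U j := by
    refine (hUj 1 (p' j) ?_).2 ?_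
    · rw [hp' j, hpctr 1]; exact hp1
    · rw [hp' j]; simp
  have hpN : ((-(x j) + (p j).1, (p j).2) : HexVertex) ∉ N (s j) := by
    rw [hp j]; simpa using hd0N
  have hp'N : ((-(x j) + (p' j).1, (p' j).2) : HexVertex) ∉ N (s j) := by
    rw [hp' j]; simpa using hd1N
  -- (7) adjacency and (9) the gate mid-edges
  have hadj : hexGraph.Adj (q j) (p j) := by
    rw [hq j, hp j]
    have := (hexGraph_adj_translate_iff (x j) ((g 0 (s j), 0) : HexVertex)
      ((g 0 (s j) - Pi.single 1 1, 1) : HexVertex)).2 (hexGraph_adj_below _)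
    simpa using this
  have hamap : (a (s j)).map (fun w : HexVertex => ((x j + w.1, w.2) : HexVertex)) = s(q j, p j) := by
    rw [ha, Sym2.map_mk, hq j, hp j]
  have hbmap : (b (s j)).map (fun w : HexVertex => ((x j + w.1, w.2) : HexVertex)) = s(q' j, p' j) := by
    rw [hb, Sym2.map_mk, hq' j, hp' j]
  -- (8) the two gate mid-edges are distinct
  have hne : s(q j, p j) ≠ s(q' j, p' j) := by
    intro h
    apply hab
    have h2 := congrArg (Sym2.map fun w : HexVertex => ((-(x j) + w.1, w.2) : HexVertex))
      (hamap.trans (h.trans hbmap.symm))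
    rwa [sym2_map_translate_neg_translate, sym2_map_translate_neg_translate] at h2
  -- (4) no bad edge
  have hΩΛ : ∀ w ∈ Λ'' j, (s j : ℂ) * hexCenter w ∈ Ω := by
    intro w hw
    obtain ⟨-, hctr, hwM⟩ := hback w hw
    rw [hctr]
    exact hMDj _ (Or.inl hwM)
  have hseg : ∀ w ∈ Λ'' j, ∀ y ∈ Λ'' j, hexGraph.Adj w y →
      segment ℝ ((s j : ℂ) * hexCenter w) ((s j : ℂ) * hexCenter y) ⊆ closure Ω := by
    intro w hw y hy hwy z hz
    obtain ⟨hwL, hctr, hwM⟩ := hback w hw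
    refine subset_closure ?_
    -- the segment lies in the closed `25 s_j`-disc about the centre of `w`
    have hzball : z ∈ closedBall ((s j : ℂ) * hexCenter w) (25 * s j) := by
      refine (convex_closedBall _ _).segment_subset (mem_closedBall_self (by positivity)) ?_ hz
      rw [mem_closedBall, dist_comm]
      exact (dist_smul_hexCenter_le_of_adj hsj.le hwy).trans (by linarith)
    -- pinned, it lies in the deep disc of the translated vertex
    have hz' : z - τj ∈ closedBall ((s j : ℂ) * hexCenter ((-(x j) + w.1, w.2) : HexVertex)) (25 * s j) := by
      rw [mem_closedBall] at hzball ⊢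
      rw [hctr] at hzball
      calc dist (z - τj) ((s j : ℂ) * hexCenter ((-(x j) + w.1, w.2) : HexVertex))
          = dist z ((s j : ℂ) * hexCenter ((-(x j) + w.1, w.2) : HexVertex) + τj) := by
            rw [dist_eq_norm, dist_eq_norm]; congr 1; ring
        _ ≤ 25 * s j := hzball
    have hz'' := (hdepthj _ hwL).1 hz'
    have hzeq : z = (z - τj) + τj := by ring
    rw [hzeq]
    refine hMDj (z - τj) ?_
    rcases hz'' with h | h
    · exact Or.inl h
    · obtain ⟨i, hi1, hi2, hi3⟩ := mem_iUnion.1 h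
      refine Or.inr ⟨i, ?_⟩
      calc dist (z - τj) (E.pt i) ≤ |((z - τj) - E.pt i).re| + |((z - τj) - E.pt i).im| :=
            dist_le_abs_re_add_abs_im _ _
        _ ≤ ρc + 30 * s j := by
            rw [Complex.sub_re, Complex.sub_im]
            refine add_le_add hi1 ?_
            rw [abs_le]; constructor <;> linarith
        _ ≤ 2 * ρc := by linarith
  have hconn'' : (hexGraph.induce (↑(Λ'' j) : Set HexVertex)).Preconnected :=
    preconnected_translate (x j) (hmem j) hconnL
  have hnobad : ∀ w ∈ Λ'' j, ∀ y ∈ Λ'' j, hexGraph.Adj w y → (hexDomainGraph Ω (s j)).Adj w y :=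
    hexDomainGraph_adj_of_geometry hΩΛ hseg hconn'' hqmem (hqdom j)
  -- (10) outer containment
  have hqN : ((-(x j) + (q j).1, (q j).2) : HexVertex) ∈ (↑(N (s j)) : Set HexVertex) := by
    rw [hq j]; simpa using hg0N
  have hcont : ∀ (w : HexVertex) (π : (hexDomainGraph Ω (s j)).Walk (q j) w),
      (∀ y ∈ π.support, y ∉ U j) → ∀ y ∈ π.support, ((-(x j) + y.1, y.2) : HexVertex) ∈ N (s j) := by
    intro w π hπ y hy
    have := outerContainment (N := (↑(N (s j)) : Set HexVertex))
      (fun z w' hz hzw => Finset.mem_coe.2 (hclosedj z w' (Finset.mem_coe.1 hz) hzw)) hqN hreachj w π hπ y hy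
    exact Finset.mem_coe.1 this
  exact ⟨hmiss, hnobad, hqmem, hpU, hp'U, hadj, hne, hamap, hbmap, hcont, hpN, hp'N⟩

end Summit.CriticalPhenomena.SAWScalingLimit.Theorems.ObservableToSLE.TypeLadder

end
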